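import Literature.NumberTheory.Rogawski1990.ArchCentralLimitNoncompactWallFirstJet    -- ★ p843058 (this seat): `deriv_cornerExtensions_eq_of_wall02_limitFormula` (any `Fz`, (J-nc)-shaped premise)
import Literature.NumberTheory.Rogawski1990.ArchLimitFormulaNoncompactWallProof     -- ★ p840819 (F0P3a-p06): `archLimitFormulaNoncompactWall_holds` — (J-nc) PROVED for CM `L`
import Literature.NumberTheory.Automorphic.ArchLocalWallCentralizerHaar             -- (this seat): `exists_isHaarMeasure_isInvInvariant_centralizer_circleDiagonal_wall` — the `νH` binder discharged
import HarnessLib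

/-!
# (J3-odd), ORDER ONE, UNCONDITIONAL for the letter's `F_Θ` (CM ground field): the first wall-normal derivatives of the two corner extensions agree on a half of the
# noncompact wall `θ₀ = θ₂` (Rogawski 1990 §8.2 p. 119 + §8.4 p. 126; Harish-Chandra's limit formula, descended, ★ PROVED in the tree)

Topic `NumberTheory/Rogawski1990`; namespace `Literature.NumberTheory.Rogawski1990`.  ONE THEOREM (no `def`, no instance, no notation, no axiom, no named fact, no `sorry`).
Cell `pub/hodgecm-mathlib`, ENGINE T1 (crux H413 = `stmt-HodgeConjecture-24833`); ROAD A toward N1 = the registered stub `stub_L21` of the rung-0 closer ED. 25 (= ★ def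
`ArchCentralLimitFormulaRankTwo`); LEAD F0P3a-plan (g10) WORD T9-8 (D), ROAD A owner F0P3a-p05 (g13); author A-p18 (g25), 2026-09-01.

**`deriv_cornerExtensions_eq_of_wall02`** = ★ `deriv_cornerExtensions_eq_of_wall02_limitFormula` with its (J-nc)-shaped premise `hJ` DISCHARGED: take `Fz := z ↦ ∫ Θ(g·t(z)·g⁻¹) dν` (the letter's
orbital integral), the frame at an INDEFINITE pair (`re σ_w α₀ · re σ_w α₂ < 0`, so `θ₀ = θ₂` is a noncompact wall), `Θ` smooth and compactly supported on `G_w`; at each wall point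
`z₀ = ζe^{itA′}` (`t ∈ S`, `cos 3t ≠ 1` ⇒ `z₀ 0 = z₀ 2 ≠ z₀ 1`) choose the inversion-invariant Haar measure `νH` on `Z(t_w z₀)` of ★ `exists_isHaarMeasure_isInvInvariant_centralizer_circleDiagonal_wall`
and the Borel structure on `G_w ⧸ Z(t_w z₀)`, and read the two-sided limit of `∂_ψ[2 sin ψ · Φ_Θ(z₀·(e^{iψ},1,e^{−iψ}))]` off ★ `archLimitFormulaNoncompactWall_holds`.  Conclusion: for the two
`C¹` corner extensions `H, H′` agreeing with `ρ′Δ·Φ_Θ∘chart` on the two sides of the normal lines (the (B-2) chamber agreements at `θ := tA′ + sN′`, §1 of ★ `…FirstJet`),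
`∀ t ∈ S, (d∕ds)|₀ H(tA′+sN′) = (d∕ds)|₀ H′(tA′+sN′)` — premise (h1) of ★ `lambda8Angle_zero_eq_of_wall02_oddJets_of_isOpen`, with NO letter hypothesis left.
HONEST LABEL: (h3) (normal cubes, (J3-odd)₃) and (A6) remain booked print rows; HC_CM is proved only modulo the printed citations until rung 0 closes.

## References
* [Rogawski1990] J. D. Rogawski, *Automorphic Representations of Unitary Groups in Three Variables*, Ann. of Math. Stud. 123 (1990), §8.2 p. 119, §8.4 pp. 126–127.
* [Varadarajan1989] V. S. Varadarajan, *An Introduction to Harmonic Analysis on Semisimple Lie Groups* (1989), §6.4 Thm 22.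
-/

set_option autoImplicit false

noncomputable section

open Filter Topology Set Complex MeasureTheory Measure NumberField NumberField.InfinitePlace
open Literature.NumberTheory.Automorphic Literature.NumberTheory.Automorphic.UnitaryGroup Literature.MeasureTheory.Group
open scoped Matrix MatrixGroups Matrix.Norms.Operator

namespace Literature.NumberTheory.Rogawski1990

section FirstJetCM

variable (L : Type) [Field L] [NumberField L] [IsCMField L] (α : Fin 3 → L) (w : {w : InfinitePlace L // IsComplex w})

/-- The wall point `ζe^{itA′} = (ζe^{it}, ζe^{−2it}, ζe^{it})` lies on the wall `θ₀ = θ₂`. [cite: Rogawski1990, §8.4 p. 126] -/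
theorem angleChart_wall02_apply_zero_eq_two (ζ : Circle) (t : ℝ) :
    (fun k : Fin 3 => ζ * Circle.exp ((t • (![1, -2, 1] : Fin 3 → ℝ)) k)) 0 = (fun k : Fin 3 => ζ * Circle.exp ((t • (![1, -2, 1] : Fin 3 → ℝ)) k)) 2 := by
  simp

/-- … and is SEMIREGULAR (`z₀ 0 ≠ z₀ 1`) as soon as `cos 3t ≠ 1` (`ζe^{it} = ζe^{−2it}` forces `e^{3it} = 1`). [cite: Rogawski1990, §8.4 p. 126] -/
theorem angleChart_wall02_apply_zero_ne_one (ζ : Circle) {t : ℝ} (ht : Real.cos (3 * t) ≠ 1) :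
    (fun k : Fin 3 => ζ * Circle.exp ((t • (![1, -2, 1] : Fin 3 → ℝ)) k)) 0 ≠ (fun k : Fin 3 => ζ * Circle.exp ((t • (![1, -2, 1] : Fin 3 → ℝ)) k)) 1 := by
  intro h
  have h' : Circle.exp (t * 1) = Circle.exp (t * -2) := by
    have := mul_left_cancel h
    simpa using this
  have h3 : Circle.exp (3 * t) = 1 := by
    have e : (3 * t : ℝ) = t * 1 - t * -2 := by ring
    rw [e, Circle.exp_sub, h', div_self']
  have hc : ((Circle.exp (3 * t) : Circle) : ℂ).re = 1 := by rw [h3]; simp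
  rw [Circle.coe_exp, Complex.exp_ofReal_mul_I_re] at hc
  exact ht (by exact_mod_cast hc)

/-- **(J3-odd), ORDER ONE, UNCONDITIONAL for `F_Θ` over a CM field.**  At an indefinite pair of the frame (`re σ_w α₀ · re σ_w α₂ < 0`), for `Θ` smooth and compactly supported on
`G_w`, a Haar measure `ν`, `ζ ∈ S¹`, and two `C¹` corner extensions `H, H′` that agree with `ρ′Δ·Φ_Θ∘chart` on the two sides of the normal lines through the wall points `ζe^{itA′}`,
`t ∈ S` (`tA′ ∈ U`, `cos 3t ≠ 1`): `∀ t ∈ S, (d∕ds)|₀ H(tA′+sN′) = (d∕ds)|₀ H′(tA′+sN′)`.  (★ `deriv_cornerExtensions_eq_of_wall02_limitFormula` + ★ `archLimitFormulaNoncompactWall_holds`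
+ ★ `exists_isHaarMeasure_isInvInvariant_centralizer_circleDiagonal_wall`.) [cite: Rogawski1990, §8.2 p. 119] [cite: Rogawski1990, §8.4 p. 126] [cite: Varadarajan1989, §6.4 Thm 22] -/
theorem deriv_cornerExtensions_eq_of_wall02
    [LocallyCompactSpace (archLocal L 3 (Matrix.diagonal α) w)] [SecondCountableTopology (archLocal L 3 (Matrix.diagonal α) w)]
    [MeasurableSpace (archLocal L 3 (Matrix.diagonal α) w)] [BorelSpace (archLocal L 3 (Matrix.diagonal α) w)]
    (hα : ∀ i, α i ≠ 0) (hreal : ∀ i, (w.1.embedding (α i)).im = 0) (hsgn : (w.1.embedding (α 0)).re * (w.1.embedding (α 2)).re < 0)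
    (ν : Measure (archLocal L 3 (Matrix.diagonal α) w)) [ν.IsHaarMeasure] [ν.IsMulRightInvariant]
    (Θ : Matrix (Fin 3) (Fin 3) ℂ → ℂ) (hΘ : ContDiff ℝ (⊤ : ℕ∞) Θ)
    (hsupp : HasCompactSupport (fun k : archLocal L 3 (Matrix.diagonal α) w => Θ ((k : GL (Fin 3) ℂ) : Matrix (Fin 3) (Fin 3) ℂ)))
    (ζ : Circle) {U : Set (Fin 3 → ℝ)} (hU : IsOpen U) {H H' : (Fin 3 → ℝ) → ℂ} (hH : ContDiffOn ℝ 1 H U) (hH' : ContDiffOn ℝ 1 H' U)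
    {S : Set ℝ} (hSU : ∀ t ∈ S, t • (![1, -2, 1] : Fin 3 → ℝ) ∈ U) (hSreg : ∀ t ∈ S, Real.cos (3 * t) ≠ 1)
    (hHF : ∀ t ∈ S, ∀ᶠ s in 𝓝[>] (0 : ℝ), H (t • (![1, -2, 1] : Fin 3 → ℝ) + s • (![1, 0, -1] : Fin 3 → ℝ)) =
      ((((ζ * Circle.exp ((t • (![1, -2, 1] : Fin 3 → ℝ) + s • (![1, 0, -1] : Fin 3 → ℝ)) 0) : Circle) : ℂ)) *
          (((ζ * Circle.exp ((t • (![1, -2, 1] : Fin 3 → ℝ) + s • (![1, 0, -1] : Fin 3 → ℝ)) 2) : Circle) : ℂ))⁻¹) *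
        ((1 - (((ζ * Circle.exp ((t • (![1, -2, 1] : Fin 3 → ℝ) + s • (![1, 0, -1] : Fin 3 → ℝ)) 1) : Circle) : ℂ)) *
              (((ζ * Circle.exp ((t • (![1, -2, 1] : Fin 3 → ℝ) + s • (![1, 0, -1] : Fin 3 → ℝ)) 0) : Circle) : ℂ))⁻¹) *
          (1 - (((ζ * Circle.exp ((t • (![1, -2, 1] : Fin 3 → ℝ) + s • (![1, 0, -1] : Fin 3 → ℝ)) 2) : Circle) : ℂ)) *
              (((ζ * Circle.exp ((t • (![1, -2, 1] : Fin 3 → ℝ) + s • (![1, 0, -1] : Fin 3 → ℝ)) 1) : Circle) : ℂ))⁻¹) *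
          (1 - (((ζ * Circle.exp ((t • (![1, -2, 1] : Fin 3 → ℝ) + s • (![1, 0, -1] : Fin 3 → ℝ)) 2) : Circle) : ℂ)) *
              (((ζ * Circle.exp ((t • (![1, -2, 1] : Fin 3 → ℝ) + s • (![1, 0, -1] : Fin 3 → ℝ)) 0) : Circle) : ℂ))⁻¹)) *
        (∫ g, Θ (((g * ⟨circleDiagonal 3 (fun k : Fin 3 => ζ * Circle.exp ((t • (![1, -2, 1] : Fin 3 → ℝ) + s • (![1, 0, -1] : Fin 3 → ℝ)) k)),
            circleDiagonal_mem_archLocal_diagonal L 3 α w _⟩ * g⁻¹ : archLocal L 3 (Matrix.diagonal α) w) : GL (Fin 3) ℂ) : Matrix (Fin 3) (Fin 3) ℂ) ∂ν))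
    (hH'F : ∀ t ∈ S, ∀ᶠ s in 𝓝[<] (0 : ℝ), H' (t • (![1, -2, 1] : Fin 3 → ℝ) + s • (![1, 0, -1] : Fin 3 → ℝ)) =
      ((((ζ * Circle.exp ((t • (![1, -2, 1] : Fin 3 → ℝ) + s • (![1, 0, -1] : Fin 3 → ℝ)) 0) : Circle) : ℂ)) *
          (((ζ * Circle.exp ((t • (![1, -2, 1] : Fin 3 → ℝ) + s • (![1, 0, -1] : Fin 3 → ℝ)) 2) : Circle) : ℂ))⁻¹) *
        ((1 - (((ζ * Circle.exp ((t • (![1, -2, 1] : Fin 3 → ℝ) + s • (![1, 0, -1] : Fin 3 → ℝ)) 1) : Circle) : ℂ)) *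
              (((ζ * Circle.exp ((t • (![1, -2, 1] : Fin 3 → ℝ) + s • (![1, 0, -1] : Fin 3 → ℝ)) 0) : Circle) : ℂ))⁻¹) *
          (1 - (((ζ * Circle.exp ((t • (![1, -2, 1] : Fin 3 → ℝ) + s • (![1, 0, -1] : Fin 3 → ℝ)) 2) : Circle) : ℂ)) *
              (((ζ * Circle.exp ((t • (![1, -2, 1] : Fin 3 → ℝ) + s • (![1, 0, -1] : Fin 3 → ℝ)) 1) : Circle) : ℂ))⁻¹) *
          (1 - (((ζ * Circle.exp ((t • (![1, -2, 1] : Fin 3 → ℝ) + s • (![1, 0, -1] : Fin 3 → ℝ)) 2) : Circle) : ℂ)) *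
              (((ζ * Circle.exp ((t • (![1, -2, 1] : Fin 3 → ℝ) + s • (![1, 0, -1] : Fin 3 → ℝ)) 0) : Circle) : ℂ))⁻¹)) *
        (∫ g, Θ (((g * ⟨circleDiagonal 3 (fun k : Fin 3 => ζ * Circle.exp ((t • (![1, -2, 1] : Fin 3 → ℝ) + s • (![1, 0, -1] : Fin 3 → ℝ)) k)),
            circleDiagonal_mem_archLocal_diagonal L 3 α w _⟩ * g⁻¹ : archLocal L 3 (Matrix.diagonal α) w) : GL (Fin 3) ℂ) : Matrix (Fin 3) (Fin 3) ℂ) ∂ν)) :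
    ∀ t ∈ S, deriv (fun s : ℝ => H (t • (![1, -2, 1] : Fin 3 → ℝ) + s • (![1, 0, -1] : Fin 3 → ℝ))) 0 =
      deriv (fun s : ℝ => H' (t • (![1, -2, 1] : Fin 3 → ℝ) + s • (![1, 0, -1] : Fin 3 → ℝ))) 0 := by
  -- the (J-nc) premise at each wall point, read off the PROVED letter with a discharged `νH`
  have hJ : ∀ t ∈ S, ∃ Lim : ℂ, Tendsto (fun ψ : ℝ => deriv (fun ψ : ℝ => (2 * Real.sin ψ : ℂ) *
      (fun z : Fin 3 → Circle => ∫ g, Θ (((g * ⟨circleDiagonal 3 z, circleDiagonal_mem_archLocal_diagonal L 3 α w z⟩ * g⁻¹ :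
        archLocal L 3 (Matrix.diagonal α) w) : GL (Fin 3) ℂ) : Matrix (Fin 3) (Fin 3) ℂ) ∂ν)
        (fun i : Fin 3 => ζ * Circle.exp ((t • (![1, -2, 1] : Fin 3 → ℝ)) i) * Circle.exp ((![(1 : ℝ), 0, -1] : Fin 3 → ℝ) i * ψ))) ψ)
      (𝓝[≠] 0) (𝓝 Lim) := by
    intro t ht
    -- the wall point and its inversion-invariant centraliser measure
    have h02 := angleChart_wall02_apply_zero_eq_two ζ t
    have h01 := angleChart_wall02_apply_zero_ne_one ζ (hSreg t ht)
    obtain ⟨νH, hνH, -, hνHinv⟩ := exists_isHaarMeasure_isInvInvariant_centralizer_circleDiagonal_wall L α w hα hreal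
      (z₁ := fun k : Fin 3 => ζ * Circle.exp ((t • (![1, -2, 1] : Fin 3 → ℝ)) k)) h02 h01
    haveI := hνH
    haveI := hνHinv
    letI : MeasurableSpace (archLocal L 3 (Matrix.diagonal α) w ⧸ Subgroup.centralizer
        ({(⟨circleDiagonal 3 (fun k : Fin 3 => ζ * Circle.exp ((t • (![1, -2, 1] : Fin 3 → ℝ)) k)),
          circleDiagonal_mem_archLocal_diagonal L 3 α w _⟩ : archLocal L 3 (Matrix.diagonal α) w)} : Set (archLocal L 3 (Matrix.diagonal α) w))) := borel _
    haveI : BorelSpace (archLocal L 3 (Matrix.diagonal α) w ⧸ Subgroup.centralizer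
        ({(⟨circleDiagonal 3 (fun k : Fin 3 => ζ * Circle.exp ((t • (![1, -2, 1] : Fin 3 → ℝ)) k)),
          circleDiagonal_mem_archLocal_diagonal L 3 α w _⟩ : archLocal L 3 (Matrix.diagonal α) w)} : Set (archLocal L 3 (Matrix.diagonal α) w))) := ⟨rfl⟩
    obtain ⟨c, -, hc⟩ := archLimitFormulaNoncompactWall_holds L α w hα hreal ν
      (fun k : Fin 3 => ζ * Circle.exp ((t • (![1, -2, 1] : Fin 3 → ℝ)) k)) h02 h01 hsgn νH
    exact ⟨_, hc Θ hΘ hsupp (fun k : Fin 3 => ζ * Circle.exp ((t • (![1, -2, 1] : Fin 3 → ℝ)) k)) h02 h01⟩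
  have key := deriv_cornerExtensions_eq_of_wall02_limitFormula
    (fun z : Fin 3 → Circle => ∫ g, Θ (((g * ⟨circleDiagonal 3 z, circleDiagonal_mem_archLocal_diagonal L 3 α w z⟩ * g⁻¹ :
      archLocal L 3 (Matrix.diagonal α) w) : GL (Fin 3) ℂ) : Matrix (Fin 3) (Fin 3) ℂ) ∂ν)
    ζ hU hH hH' hSU hSreg
  beta_reduce at key
  exact key hHF hH'F hJ

end FirstJetCM

end Literature.NumberTheory.Rogawski1990

end
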